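import Mathlib
import Summits.ValiantsHypothesis.ValiantsHypothesis.Theorems.SuccinctLiftSmlPlog

/-!
# SuccinctLift — set-multilinear parts of a product gate over ANY field

Third support file of the characteristic-free set-multilinear product expansion (wall D of
`route-ValiantsHypothesis-SuccinctLift`, stmt-ValiantsHypothesis-23721, census cell W34 «2-non-unit
cut»; target: Forbes's theorem that the Limaye–Srinivasan–Tavenas low-depth lower bounds hold over every
field).  For factors `g_k` with UNIT constant terms `u_k`,
`(∏_k g_k)_S = (∏_k u_k) • pexp (∑_k M_k) (S)` with `M_k = plog ((u_k⁻¹ g_k)_•)` (`smlProj_prod_units`):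
ONE product layer over class sums, each class sum one product layer over the parts `(g_k)_P` — product
depth `2` per original product gate, with all intermediate polynomials set-multilinear.  Factors with
zero constant term are shifted by `+1` (`unitize`) and recovered by inclusion–exclusion over the at most
`|S|` of them that can contribute (`prod_eq_sum_prod_unitize`, `smlProj_mul_prod_eq_zero_of_card_lt`).
The packaged statement `prod_gate_expansion` (scalars `a, b` with
`(∏_k f_k)_S = ∑_{(T,e)} b_S(T,e) • labTerm (Q ↦ ∑_{(k,e')} a_T(Q)(k,e') • labTerm ((f_k)_•) Q e') S e`
for every block set `S`) is what the gate-by-gate circuit conversion consumes.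

References: Forbes2024LowDepth (CCC 2024, Thm. 1: "the same lower bounds hold over any field … via the
Binet–Minc identity"); LimayeSrinivasanTavenas2025 (J. ACM 72, Lemma 12); Minc 1978 (Permanents, §2).
-/

noncomputable section

open MvPolynomial Finset

-- the summit and the problem share the name `ValiantsHypothesis` (D-0017 single-conjunct layout)
set_option linter.dupNamespace false

namespace Summit.ValiantsHypothesis.ValiantsHypothesis.Theorems.SuccinctLiftSmlProduct

open Literature.Computability.AlgebraicComplexity SuccinctLiftSmlConvolution SuccinctLiftSmlPlog

universe u v w

section Sml

variable {K : Type u} [Field K] {σ : Type v} {ι : Type w} [DecidableEq ι] (blk : σ → ι)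

/-- **Unit constant terms**: if every factor `g_k` has a nonzero constant term `u_k` and
`M_k = plog ((u_k⁻¹ g_k)_•)`, then `(∏_k g_k)_S = (∏_k u_k) • pexp (∑_k M_k) (S)` — ONE product layer
over class sums. [cite: Forbes2024LowDepth, Thm. 1] [cite: LimayeSrinivasanTavenas2025, Lemma 12] -/
theorem smlProj_prod_units {κ : Type*} [DecidableEq κ] (U : Finset κ) (g : κ → MvPolynomial σ K)
    (u : κ → K) (hu0 : ∀ k ∈ U, u k ≠ 0) (M : κ → Finset ι → MvPolynomial σ K)
    (hM : ∀ k ∈ U, ∀ B : Finset ι, pexp (M k) B = smlProj blk B ((u k)⁻¹ • g k)) (S : Finset ι) :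
    smlProj blk S (∏ k ∈ U, g k) = (∏ k ∈ U, u k) • pexp (fun Q => ∑ k ∈ U, M k Q) S := by
  classical
  induction U using Finset.induction_on generalizing S with
  | empty =>
    rw [Finset.prod_empty, Finset.prod_empty, one_smul, ← C_1, smlProj_C]
    simp_rw [Finset.sum_empty]
    rw [pexp_zero]
    split_ifs <;> simp
  | insert a U ha ih =>
    have hga : ∀ S₁, smlProj blk S₁ (g a) = u a • pexp (M a) S₁ := fun S₁ => by
      rw [hM a (Finset.mem_insert_self _ _), ← map_smul, smul_smul,
        mul_inv_cancel₀ (hu0 a (Finset.mem_insert_self _ _)), one_smul]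
    have ih' := ih (fun k hk => hu0 k (Finset.mem_insert_of_mem hk))
      (fun k hk => hM k (Finset.mem_insert_of_mem hk))
    rw [Finset.prod_insert ha, Finset.prod_insert ha, smlProj_mul]
    simp_rw [hga, ih', Finset.sum_insert ha]
    rw [pexp_add, conv, Finset.smul_sum]
    refine Finset.sum_congr rfl fun S₁ _ => ?_
    rw [smul_mul_smul_comm, mul_smul]

/-- **Too many constant-free factors kill the low set-multilinear parts**: if `|S| < |Z|` and every
`f_k`, `k ∈ Z`, has zero constant term then `(h · ∏_{k ∈ Z} f_k)_S = 0`.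
[cite: LimayeSrinivasanTavenas2025, Lemma 12] -/
theorem smlProj_mul_prod_eq_zero_of_card_lt {κ : Type*} [DecidableEq κ] (Z : Finset κ)
    (f : κ → MvPolynomial σ K) (hz : ∀ k ∈ Z, coeff 0 (f k) = 0) (h : MvPolynomial σ K)
    (S : Finset ι) (hS : S.card < Z.card) : smlProj blk S (h * ∏ k ∈ Z, f k) = 0 := by
  classical
  induction Z using Finset.induction_on generalizing S h with
  | empty => simp at hS
  | insert a Z ha ih =>
    rw [Finset.prod_insert ha, mul_comm (f a), ← mul_assoc, smlProj_mul]
    refine Finset.sum_eq_zero fun S₁ hS₁ => ?_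
    rw [Finset.mem_powerset] at hS₁
    by_cases hS₁S : S₁ = S
    · rw [hS₁S, Finset.sdiff_self, smlProj_empty, hz a (Finset.mem_insert_self _ _), C_0, mul_zero]
    · have hlt : S₁.card < S.card := Finset.card_lt_card (Finset.ssubset_iff_subset_ne.2 ⟨hS₁, hS₁S⟩)
      rw [Finset.card_insert_of_notMem ha] at hS
      rw [ih (fun k hk => hz k (Finset.mem_insert_of_mem hk)) h S₁ (by omega), zero_mul]

open Classical in
/-- Shifting a constant-free factor to unit constant term: `unitize f = f + 1` if `f(0) = 0`, else `f`.
[cite: Forbes2024LowDepth, §1.2] -/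
def unitize (f : MvPolynomial σ K) : MvPolynomial σ K := if coeff 0 f = 0 then f + 1 else f

open Classical in
/-- `unitize f` has a nonzero constant term. [folklore] -/
theorem coeff_zero_unitize_ne_zero (f : MvPolynomial σ K) : coeff 0 (unitize f) ≠ 0 := by
  unfold unitize
  split_ifs with h
  · rw [coeff_add, h, zero_add, ← C_1, coeff_zero_C]; exact one_ne_zero
  · exact h

open Classical in
/-- `unitize` does not change the set-multilinear parts over nonempty block sets. [folklore] -/
theorem smlProj_unitize {S : Finset ι} (hS : S.Nonempty) (f : MvPolynomial σ K) :
    smlProj blk S (unitize f) = smlProj blk S f := by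
  classical
  unfold unitize
  split_ifs with h
  · rw [map_add, ← C_1, smlProj_C, if_neg hS.ne_empty, add_zero]
  · rfl

open Classical in
/-- **Inclusion–exclusion over the constant-free factors**: with `Z = {k ∈ I : f_k(0) = 0}`,
`∏_{k ∈ I} f_k = ∑_{Z' ⊆ Z} (−1)^{|Z ∖ Z'|} ∏_{k ∈ (I ∖ Z) ∪ Z'} unitize f_k`, all factors on the right
having unit constant terms. [cite: Forbes2024LowDepth, §1.2] -/
theorem prod_eq_sum_prod_unitize {κ : Type*} [DecidableEq κ] (I : Finset κ) (f : κ → MvPolynomial σ K) :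
    ∏ k ∈ I, f k = ∑ Z' ∈ (I.filter fun k => coeff 0 (f k) = 0).powerset,
      ((-1 : K) ^ ((I.filter fun k => coeff 0 (f k) = 0) \ Z').card) •
        ∏ k ∈ (I \ I.filter fun k => coeff 0 (f k) = 0) ∪ Z', unitize (f k) := by
  classical
  set Z := I.filter fun k => coeff 0 (f k) = 0 with hZ
  have hsplit : ∏ k ∈ I, f k = (∏ k ∈ I \ Z, unitize (f k)) * ∏ k ∈ Z, (unitize (f k) + (-1)) := by
    rw [← Finset.prod_sdiff (Finset.filter_subset _ I : Z ⊆ I)]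
    congr 1
    · refine Finset.prod_congr rfl fun k hk => ?_
      rw [Finset.mem_sdiff, hZ, Finset.mem_filter] at hk
      rw [unitize, if_neg (fun h => hk.2 ⟨hk.1, h⟩)]
    · refine Finset.prod_congr rfl fun k hk => ?_
      rw [hZ, Finset.mem_filter] at hk
      rw [unitize, if_pos hk.2]; ring
  rw [hsplit, Finset.prod_add, Finset.mul_sum]
  refine Finset.sum_congr rfl fun Z' hZ' => ?_
  rw [Finset.mem_powerset] at hZ'
  have hdj : Disjoint (I \ Z) Z' := Finset.disjoint_of_subset_right hZ' Finset.sdiff_disjoint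
  rw [Finset.prod_union hdj, Finset.prod_const, smul_eq_C_mul, map_pow, map_neg, C_1]
  ring

end Sml

/-! ### The product-gate expansion handed to the circuit conversion -/

section Export

variable {K : Type u} [Field K] {σ : Type v} {ι : Type w} [DecidableEq ι] [Fintype ι] (blk : σ → ι)

/-- A labelled term in set-multilinear functions is set-multilinear over `S` (the nonempty fibres of
the labelling partition `S`). [cite: LimayeSrinivasanTavenas2025, Claim 7] -/
theorem isSetMultilinear_labTerm (N : Finset ι → MvPolynomial σ K)
    (hN : ∀ P : Finset ι, P.Nonempty → IsSetMultilinear blk P (N P)) (S : Finset ι) (e : ι → ι) :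
    IsSetMultilinear blk S (labTerm N S e) := by
  classical
  have key : ∀ T : Finset ι, IsSetMultilinear blk (T.biUnion (fib S e))
      (∏ l ∈ T, if (fib S e l).Nonempty then N (fib S e l) else 1) := by
    intro T
    induction T using Finset.induction_on with
    | empty =>
      rw [Finset.biUnion_empty, Finset.prod_empty, ← C_1]
      exact isSetMultilinear_C blk 1
    | insert l T hl ih =>
      rw [Finset.biUnion_insert, Finset.prod_insert hl]
      refine IsSetMultilinear.mul blk ?_ ih ?_
      · split_ifs with h
        · exact hN _ h
        · rw [Finset.not_nonempty_iff_eq_empty.1 h, ← C_1]; exact isSetMultilinear_C blk 1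
      · rw [Finset.disjoint_biUnion_right]
        intro l' hl'
        rw [fib, fib, Finset.disjoint_filter]
        rintro i _ rfl h; exact hl (h ▸ hl')
  have hS : (Finset.univ : Finset ι).biUnion (fib S e) = S := by
    ext i
    simp only [Finset.mem_biUnion, Finset.mem_univ, true_and, fib, Finset.mem_filter]
    exact ⟨fun ⟨_, hi, _⟩ => hi, fun hi => ⟨e i, hi, rfl⟩⟩
  have := key Finset.univ
  rwa [hS] at this

omit [DecidableEq ι] [Fintype ι] in
/-- Set-multilinear polynomials over `S` are homogeneous of degree `|S|`. [folklore] -/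
theorem IsSetMultilinear.isHomogeneous_card {S : Finset ι} {f : MvPolynomial σ K}
    (hf : IsSetMultilinear blk S f) : f.IsHomogeneous S.card := by
  classical
  rw [IsHomogeneous, IsWeightedHomogeneous]
  intro m hm
  have h := hf hm
  rw [weight_blockWeight_eq_mapDomain] at h
  have hdeg : (Finsupp.mapDomain blk m).sum (fun _ n => n) = m.sum (fun _ n => n) :=
    Finsupp.sum_mapDomain_index (fun _ => rfl) (fun _ _ _ => rfl)
  rw [h] at hdeg
  have hprof : (blockProfile S).sum (fun _ n => n) = S.card := by
    rw [blockProfile, ← Finsupp.sum_finsetSum_index (fun _ => rfl) (fun _ _ _ => rfl)]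
    simp [Finsupp.sum_single_index]
  rw [← hprof, hdeg, Finsupp.weight_apply]
  simp [Finsupp.sum]

/-- **The product-gate expansion** (char-free Binet–Minc / exp–log form of LST's set-multilinearisation,
Forbes 2024): for factors `f_k`, `k : κ`, there are scalars `a, b` such that for EVERY block set `S`
`(∏_k f_k)_S = ∑_{(T,e)} b_S(T,e) • labTerm (Q ↦ ∑_{(k,e')} a_T(Q)(k,e') • labTerm ((f_k)_•) Q e') S e` —
two product layers (the `labTerm`s, fan-in `|ι|`) and two linear layers, over the index sets
`Finset ι × (ι → ι)` and `κ × (ι → ι)` only. [cite: Forbes2024LowDepth, Thm. 1]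
[cite: LimayeSrinivasanTavenas2025, Lemma 12] -/
theorem prod_gate_expansion {κ : Type*} [Fintype κ] [DecidableEq κ] (f : κ → MvPolynomial σ K) :
    ∃ (a : Finset ι → Finset ι → κ × (ι → ι) → K) (b : Finset ι → Finset ι × (ι → ι) → K),
      ∀ S : Finset ι, smlProj blk S (∏ k, f k) =
        ∑ x : Finset ι × (ι → ι), b S x •
          labTerm (fun Q => ∑ y : κ × (ι → ι), a x.1 Q y • labTerm (fun P => smlProj blk P (f y.1)) Q y.2)
            S x.2 := by
  classical
  -- the constant-free factors, the unitised factors and their constant terms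
  set Z : Finset κ := Finset.univ.filter fun k => coeff 0 (f k) = 0 with hZ
  set g : κ → MvPolynomial σ K := fun k => unitize (f k) with hg
  set u : κ → K := fun k => coeff 0 (g k) with hu
  have hu0 : ∀ k, u k ≠ 0 := fun k => coeff_zero_unitize_ne_zero (f k)
  set L : κ → Finset ι → MvPolynomial σ K := fun k P => smlProj blk P ((u k)⁻¹ • g k) with hL
  have hL0 : ∀ k, L k ∅ = 1 := fun k => by
    simp only [hL, smlProj_empty, coeff_smul, smul_eq_mul]
    rw [inv_mul_cancel₀ (hu0 k), C_1]
  -- the combinatorial logarithms `M k` and their coordinates in the labelled terms of `(f_k)_•`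
  have hM : ∀ k, ∃ M : Finset ι → MvPolynomial σ K, (∀ B, pexp M B = L k B) ∧
      ∀ Q, ∃ c : (ι → ι) → K, ∑ e, c e • labTerm (fun P => smlProj blk P (f k)) Q e = M Q := by
    intro k
    obtain ⟨M, hMB, hMspan⟩ := exists_plog (R := K) (L k) (hL0 k) (Fintype.card ι)
    refine ⟨M, fun B => hMB B (Finset.card_le_univ B), fun Q => ?_⟩
    refine (Submodule.mem_span_range_iff_exists_fun K).1 ?_
    have h1 : M Q ∈ Submodule.span K (Set.range (labTerm (L k) Q)) :=
      Submodule.span_mono (plogGen_subset_range_labTerm (L k) Q) (hMspan Q)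
    refine (Submodule.span_le.2 ?_) h1
    rintro x ⟨e, rfl⟩
    -- `labTerm (L k) Q e` is a scalar multiple of `labTerm ((f k)_•) Q e`
    have hscal : labTerm (L k) Q e = (∏ l, if (fib Q e l).Nonempty then (u k)⁻¹ else (1 : K)) •
        labTerm (fun P => smlProj blk P (f k)) Q e := by
      rw [labTerm, labTerm, ← Finset.prod_smul]
      refine Finset.prod_congr rfl fun l _ => ?_
      split_ifs with h
      · simp only [hL, map_smul]
        rw [hg]; dsimp only; rw [smlProj_unitize blk h]
      · rw [one_smul]
    rw [hscal]
    exact Submodule.smul_mem _ _ (Submodule.subset_span ⟨e, rfl⟩)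
  choose M hMpexp hMc using hM
  choose mc hmc using hMc
  -- degenerate case: more constant-free factors than blocks ⇒ all set-multilinear parts vanish
  have hsplit : ∏ k, f k = (∏ k ∈ Finset.univ \ Z, f k) * ∏ k ∈ Z, f k :=
    (Finset.prod_sdiff (Finset.subset_univ Z)).symm
  have hzero : ∀ S : Finset ι, S.card < Z.card → smlProj blk S (∏ k, f k) = 0 := fun S hS => by
    rw [hsplit]
    exact smlProj_mul_prod_eq_zero_of_card_lt blk Z f
      (fun k hk => by rw [hZ, Finset.mem_filter] at hk; exact hk.2) _ S hS
  by_cases hZι : Z.card ≤ Fintype.card ι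
  swap
  · refine ⟨fun _ _ _ => 0, fun _ _ => 0, fun S => ?_⟩
    rw [hzero S (lt_of_le_of_lt (Finset.card_le_univ S) (not_le.1 hZι))]
    simp
  -- encode the subsets `Z' ⊆ Z` by block sets `T` through an injection `ψ : Z ↪ ι`
  obtain ⟨ψ⟩ := Function.Embedding.nonempty_iff_card_le.2 (by rwa [Fintype.card_coe] : Fintype.card Z ≤ Fintype.card ι)
  set Zof : Finset ι → Finset κ := fun T => Finset.univ.filter fun k => ∃ h : k ∈ Z, ψ ⟨k, h⟩ ∈ T with hZof
  set Tof : Finset κ → Finset ι := fun Z' => Finset.univ.filter fun l => ∃ k, ∃ h : k ∈ Z, k ∈ Z' ∧ ψ ⟨k, h⟩ = l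
    with hTof
  have hZT : ∀ Z' ∈ Z.powerset, Zof (Tof Z') = Z' := by
    intro Z' hZ'
    rw [Finset.mem_powerset] at hZ'
    ext k
    simp only [hZof, hTof, Finset.mem_filter, Finset.mem_univ, true_and]
    constructor
    · rintro ⟨hk, k', hk', hk'Z', he⟩
      have := ψ.injective he
      rw [Subtype.mk.injEq] at this
      exact this ▸ hk'Z'
    · intro hk
      exact ⟨hZ' hk, k, hZ' hk, hk, rfl⟩
  have hTinj : Set.InjOn Tof (Z.powerset : Set (Finset κ)) := by
    intro Z₁ h₁ Z₂ h₂ h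
    rw [← hZT Z₁ h₁, ← hZT Z₂ h₂, h]
  -- the unit-group index sets and the class sums
  set U : Finset κ → Finset κ := fun Z' => (Finset.univ \ Z) ∪ Z' with hU
  set N : Finset κ → Finset ι → MvPolynomial σ K := fun Z' Q => ∑ k ∈ U Z', M k Q with hN
  have hc : ∀ (S : Finset ι) (Z' : Finset κ), ∃ c : (ι → ι) → K,
      ∑ e, c e • labTerm (N Z') S e = pexp (N Z') S := fun S Z' =>
    (Submodule.mem_span_range_iff_exists_fun K).1 (pexp_mem_span_labTerm (N Z') S)
  choose c hcN using hc
  -- the coefficients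
  set a : Finset ι → Finset ι → κ × (ι → ι) → K := fun T Q y => if y.1 ∈ U (Zof T) then mc y.1 Q y.2 else 0
    with ha
  set w : Finset ι → Finset κ → (ι → ι) → K := fun S Z' e =>
    ((-1 : K) ^ (Z \ Z').card * ∏ k ∈ U Z', u k) * c S Z' e with hw
  set b : Finset ι → Finset ι × (ι → ι) → K := fun S x =>
    if Z.card ≤ S.card then (if x.1 ∈ Z.powerset.image Tof then w S (Zof x.1) x.2 else 0) else 0 with hb
  have hinner : ∀ T : Finset ι,
      (fun Q => ∑ y : κ × (ι → ι), a T Q y • labTerm (fun P => smlProj blk P (f y.1)) Q y.2) = N (Zof T) := by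
    intro T
    funext Q
    rw [Fintype.sum_prod_type, hN]
    dsimp only
    rw [← Finset.sum_filter_add_sum_filter_not Finset.univ (fun k => k ∈ U (Zof T))]
    have h2 : ∑ k ∈ Finset.univ.filter (fun k => ¬ k ∈ U (Zof T)),
        ∑ e, a T Q (k, e) • labTerm (fun P => smlProj blk P (f k)) Q e = 0 := by
      refine Finset.sum_eq_zero fun k hk => Finset.sum_eq_zero fun e _ => ?_
      rw [Finset.mem_filter] at hk
      rw [ha]; dsimp only; rw [if_neg hk.2, zero_smul]
    rw [h2, add_zero, Finset.filter_mem_eq_inter, Finset.univ_inter]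
    refine Finset.sum_congr rfl fun k hk => ?_
    rw [← hmc k Q]
    refine Finset.sum_congr rfl fun e _ => ?_
    rw [ha]; dsimp only; rw [if_pos hk]
  refine ⟨a, b, fun S => ?_⟩
  simp_rw [hinner]
  by_cases hSZ : Z.card ≤ S.card
  swap
  · rw [hzero S (not_le.1 hSZ)]
    refine (Finset.sum_eq_zero fun x _ => ?_).symm
    rw [hb]; dsimp only; rw [if_neg hSZ, zero_smul]
  -- main case: inclusion–exclusion, unit-constant expansion, labelled coordinates
  have hlhs : smlProj blk S (∏ k, f k) =
      ∑ Z' ∈ Z.powerset, ∑ e, w S Z' e • labTerm (N Z') S e := by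
    rw [prod_eq_sum_prod_unitize (K := K) Finset.univ f, map_sum]
    refine Finset.sum_congr rfl fun Z' hZ' => ?_
    rw [map_smul]
    have hunits := smlProj_prod_units blk (U Z') g u (fun k _ => hu0 k) M
      (fun k _ B => by rw [hMpexp k B]) S
    rw [hunits, ← hcN S Z', Finset.smul_sum, Finset.smul_sum]
    refine Finset.sum_congr rfl fun e _ => ?_
    rw [hw]; dsimp only
    rw [smul_smul, smul_smul]
  have hrhs : ∑ x : Finset ι × (ι → ι), b S x • labTerm (N (Zof x.1)) S x.2 =
      ∑ Z' ∈ Z.powerset, ∑ e, w S Z' e • labTerm (N Z') S e := by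
    rw [Fintype.sum_prod_type]
    rw [← Finset.sum_subset (Finset.subset_univ (Z.powerset.image Tof))]
    · rw [Finset.sum_image hTinj]
      refine Finset.sum_congr rfl fun Z' hZ' => Finset.sum_congr rfl fun e _ => ?_
      rw [hb]; dsimp only
      rw [if_pos hSZ, if_pos (Finset.mem_image_of_mem Tof hZ'), hZT Z' hZ']
    · intro T _ hT
      refine Finset.sum_eq_zero fun e _ => ?_
      rw [hb]; dsimp only
      rw [if_pos hSZ, if_neg hT, zero_smul]
  rw [hlhs, hrhs]

end Export

end Summit.ValiantsHypothesis.ValiantsHypothesis.Theorems.SuccinctLiftSmlProduct
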